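import Summits.CriticalPhenomena.PercolationContinuityZ3.Theorems.Transplant.FKConnectivityAllQAntipodalAnd4Theta
import Summits.CriticalPhenomena.PercolationContinuityZ3.Theorems.Transplant.FKConnectivityAllQAntipodalAnd4Contracted
import HarnessLib

/-!
# Connectivity correlation inequalities for `φ_{w,q}`, every `q > 0` — file 29b: `C_∞(and_S)` FOR THE 3-EDGE PATH `S = P₄` ACROSS A THETA
# JUNCTION — the assembled theorem

Support file (`--supports stmt-CriticalPhenomena-4575`), FK sub-lane `prim-bschramm-fk-2` (gen 19) of the post-continuity programme; builds
on p205010 (kernel theorem, internal audit signed; external expert review pending).  No definitions, no named facts, no sorries; standard axioms.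

`…AntipodalAnd4Theta.lean` proved the R-extension theorem `FK.and4_theta_nonpos`: the AND-drift of `S = {ab, bc, cd}` on `N = M ⊔_{b,c} R` is
`≤ 0` (`0 < q ≤ 1`) as soon as (i) the AND-drift of `S` on `M` is `≤ 0`, (ii) the `bc`-contracted AND-drift of `S` on `M` is `≤ 0`, and (iii)
the Theorem-U functional of `R` (terminals `b, c`) is `≥ 0`, all on monotone test functions; `…AntipodalAnd4Contracted.lean` proved (ii) for
every two-terminal series–parallel network through the end edges (`FK.andc_side_nonpos`).  THIS FILE assembles the THETA junction:
**`FK.apPsi_and_path3_theta_nonpos`** — for `A′ = N₁ ∪ {ab}` TTSP between `b, m` and `A″ = N₂ ∪ {cd}` TTSP between `m, c` (edge-disjoint,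
meeting only in `m`, `b` off `A″`, `c` off `A′`, without the junction edges `bm`, `mc`) and a two-terminal series–parallel `R` between `b, c`
(edge-disjoint from `A′ ∪ A″`, spanned vertices meeting those of `A′ ∪ A″` only inside `{b, c}`, `bc ∉ R`), with `H = A′ ∪ A″ ∪ R ∪ {bc}`:
`apPsi q H 1_{{ab,bc,cd} ⊆ ·} g ≤ 0` for every `0 < q ≤ 1` and every increasing `g` on `N₁ ∪ N₂ ∪ R` not reading `ab, bc, cd` — gen 10's
Conjecture `C_∞` for the AND type on a 3-edge PATH whose middle-edge complement `H \ bc = (A′ · A″) ∥ R` has a PARALLEL root with both end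
edges in ONE series child: the THETA junction, the last of the three junction types of memo `bschramm/FROM-fk-2-g18-AND-WORDHALL.md` §7A
(series: file 27a; parallel, different children: file 28a).  Inputs: (i) file 27's `and4_series_nonpos` with gen 11's side inputs, (ii)
`andc_side_nonpos` for `K = A′ · A″` (TTSP between `b, c` by `IsTTSP.series`), (iii) Theorem U on `R` (`apUpc_nonneg_of_isTTSP`).  The
unconditional theorem for every 2-connected series–parallel host (no condition on `bm`, `mc`; induction over `H \ bc`) is file 30a.
[cite: Grimmett2006, §1.4 eq. (1.20) (p. 15); §3.8 Thm. (3.90) (pp. 61–62); §3.9 (pp. 63–64)] [cite: Wagner2006, Thm. 5.8(d), §5.3]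
-/

noncomputable section

namespace Summit.CriticalPhenomena.PercolationContinuityZ3.Theorems

namespace FK

open SimpleGraph Literature.Probability.LatticeModels Literature.Probability.Percolation
open scoped Classical

variable {V : Type*} [Fintype V]

/-! ### `C_∞(and_S)` for the 3-edge path across a theta junction -/

section Main

variable {a b m c d : V}

omit [Fintype V] in
/-- The AND configuration of the theta junction: `(N₁ ∪ N₂ ∪ R) ∪ {ab, bc, cd} = (N₁ ∪ {ab}) ∪ (N₂ ∪ {cd}) ∪ R ∪ {bc}` as finsets. [folklore] -/
theorem union_path3_theta_eq (N₁ N₂ R : Finset (Sym2 V)) (a b c d : V) :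
    N₁ ∪ N₂ ∪ R ∪ {s(a, b), s(b, c), s(c, d)} = insert s(b, c) (insert s(a, b) N₁ ∪ insert s(c, d) N₂ ∪ R) := by
  ext e
  simp only [Finset.mem_union, Finset.mem_insert, Finset.mem_singleton]
  tauto

/-- **THEOREM (`C_∞` at level 3 for `S = P₄`, theta junction).**  Let `A′ = N₁ ∪ {ab}` be a two-terminal series–parallel network between
`b` and `m` and `A″ = N₂ ∪ {cd}` one between `m` and `c`, edge-disjoint, meeting only in `m`, with `b` off `A″`, `c` off `A′`, without the
junction edges `bm`, `mc`; and let `R` be a two-terminal series–parallel network between `b` and `c`, edge-disjoint from `A′ ∪ A″`, whose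
spanned vertices meet those of `A′ ∪ A″` only inside `{b, c}`, with `bc ∉ R`.  Then for `H = A′ ∪ A″ ∪ R ∪ {bc}` — a 2-connected
series–parallel graph whose `H \ bc = (A′ · A″) ∥ R` has a PARALLEL root with both end edges `ab`, `cd` inside the series child `A′ · A″` —
the path `S = {ab, bc, cd} ⊆ H`, every `0 < q ≤ 1` and every increasing `g` not reading `S`: `apPsi q H 1_{S ⊆ ·} g ≤ 0`, i.e. every
square-free coefficient of `Z_H² Cov_{φ_{z,q}}(ω_{ab} ω_{bc} ω_{cd}, g)` is `≤ 0` — gen 10's Conjecture `C_∞` for the AND type on three edges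
forming a path, in the THETA case.  Proof: `apPsi_andInd_eq` + the R-extension theorem `and4_theta_nonpos`, whose inputs are file 27's
`and4_series_nonpos` (with gen 11's side inputs `and2_side_nonpos`, `and1_side_nonpos`), the contracted side input `andc_side_nonpos`
(for `K = A′ · A″`, TTSP between `b, c` by `IsTTSP.series`),
and Theorem U on `R` (`apUpc_nonneg_of_isTTSP`).
[cite: Grimmett2006, §3.8 Thm. (3.90) (pp. 61–62); §3.9 (pp. 63–64)] [cite: Wagner2006, Thm. 5.8(d), §5.3] -/
theorem apPsi_and_path3_theta_nonpos {q : ℝ} (hq0 : 0 < q) (hq1 : q ≤ 1) {N₁ N₂ R : Finset (Sym2 V)}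
    (hA₁ : IsTTSP (insert s(a, b) N₁) b m) (hA₂ : IsTTSP (insert s(c, d) N₂) m c) (hR : IsTTSP R b c)
    (habN : s(a, b) ∉ N₁) (hcdN : s(c, d) ∉ N₂)
    (hd : Disjoint (insert s(a, b) N₁) (insert s(c, d) N₂))
    (hdR₁ : Disjoint (insert s(a, b) N₁) R) (hdR₂ : Disjoint (insert s(c, d) N₂) R)
    (hV : ∀ z : V, (∃ e ∈ insert s(a, b) N₁, z ∈ e) → (∃ e ∈ insert s(c, d) N₂, z ∈ e) → z = m)
    (hbA₂ : ∀ e ∈ insert s(c, d) N₂, b ∉ e) (hcA₁ : ∀ e ∈ insert s(a, b) N₁, c ∉ e)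
    (hVR : ∀ z : V, ((∃ e ∈ insert s(a, b) N₁, z ∈ e) ∨ (∃ e ∈ insert s(c, d) N₂, z ∈ e)) → (∃ e ∈ R, z ∈ e) → z = b ∨ z = c)
    (hbm : s(b, m) ∉ insert s(a, b) N₁) (hmc : s(m, c) ∉ insert s(c, d) N₂) (hbcR : s(b, c) ∉ R)
    {g : Finset (Sym2 V) → ℝ} (hg : ∀ A T : Finset (Sym2 V), T ⊆ {s(a, b), s(b, c), s(c, d)} → g (A ∪ T) = g A)
    (hmono : ∀ ⦃A B : Finset (Sym2 V)⦄, A ⊆ B → B ⊆ N₁ ∪ N₂ ∪ R → g A ≤ g B) :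
    apPsi q (insert s(b, c) (insert s(a, b) N₁ ∪ insert s(c, d) N₂ ∪ R))
      (fun X => if ({s(a, b), s(b, c), s(c, d)} : Finset (Sym2 V)) ⊆ X then 1 else 0) g ≤ 0 := by
  -- distinctness
  have hbm' : b ≠ m := hA₁.ne
  have hcm' : c ≠ m := hA₂.ne.symm
  have hbc : b ≠ c := hR.ne
  -- vertex sets of the two series sides
  set V₁ : Set V := {z | ∃ e ∈ insert s(a, b) N₁, z ∈ e} with hV₁
  set V₂ : Set V := {z | ∃ e ∈ insert s(c, d) N₂, z ∈ e} with hV₂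
  have h₁ : ∀ e ∈ (↑(insert s(a, b) N₁) : Set (Sym2 V)), ∀ z ∈ e, z ∈ V₁ := fun e he z hz => ⟨e, he, hz⟩
  have h₂ : ∀ e ∈ (↑(insert s(c, d) N₂) : Set (Sym2 V)), ∀ z ∈ e, z ∈ V₂ := fun e he z hz => ⟨e, he, hz⟩
  have hS : V₁ ∩ V₂ ⊆ ({m} : Set V) := fun z hz => hV z hz.1 hz.2
  have hbV₂ : b ∉ V₂ := fun ⟨e, he, hbe⟩ => hbA₂ e he hbe
  have hcV₁ : c ∉ V₁ := fun ⟨e, he, hce⟩ => hcA₁ e he hce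
  have hdN : Disjoint N₁ N₂ :=
    Finset.disjoint_of_subset_left (Finset.subset_insert _ _) (Finset.disjoint_of_subset_right (Finset.subset_insert _ _) hd)
  have hdNR : Disjoint (N₁ ∪ N₂) R := by
    rw [Finset.disjoint_union_left]
    exact ⟨Finset.disjoint_of_subset_left (Finset.subset_insert _ _) hdR₁,
      Finset.disjoint_of_subset_left (Finset.subset_insert _ _) hdR₂⟩
  -- `S` is disjoint from `N = N₁ ⊔ N₂ ⊔ R`
  have hNS : Disjoint (N₁ ∪ N₂ ∪ R) ({s(a, b), s(b, c), s(c, d)} : Finset (Sym2 V)) := by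
    refine Finset.disjoint_left.2 fun e he heS => ?_
    simp only [Finset.mem_insert, Finset.mem_singleton] at heS
    rcases Finset.mem_union.1 he with he | h
    · rcases Finset.mem_union.1 he with h | h
      · rcases heS with rfl | rfl | rfl
        · exact habN h
        · exact hcA₁ _ (Finset.mem_insert_of_mem h) (Sym2.mem_mk_right b c)
        · exact hcA₁ _ (Finset.mem_insert_of_mem h) (Sym2.mem_mk_left c d)
      · rcases heS with rfl | rfl | rfl
        · exact hbA₂ _ (Finset.mem_insert_of_mem h) (Sym2.mem_mk_right a b)
        · exact hbA₂ _ (Finset.mem_insert_of_mem h) (Sym2.mem_mk_left b c)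
        · exact hcdN h
    · rcases heS with rfl | rfl | rfl
      · exact Finset.disjoint_left.1 hdR₁ (Finset.mem_insert_self _ _) h
      · exact hbcR h
      · exact Finset.disjoint_left.1 hdR₂ (Finset.mem_insert_self _ _) h
  rw [← union_path3_theta_eq N₁ N₂ R a b c d, apPsi_andInd_eq q hNS ⟨s(a, b), Finset.mem_insert_self _ _⟩ hg]
  -- ambient sets for the theta gluing: the `M`-side is `H \ R`, the `R`-side is `R`
  set E₁ : Finset (Sym2 V) := insert s(b, c) (insert s(a, b) N₁ ∪ insert s(c, d) N₂) with hE₁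
  set W₁ : Set V := {z | ∃ e ∈ E₁, z ∈ e} with hW₁
  set W₂ : Set V := {z | ∃ e ∈ R, z ∈ e} with hW₂
  have k₁ : ∀ e ∈ (↑E₁ : Set (Sym2 V)), ∀ z ∈ e, z ∈ W₁ := fun e he z hz => ⟨e, he, hz⟩
  have k₂ : ∀ e ∈ (↑R : Set (Sym2 V)), ∀ z ∈ e, z ∈ W₂ := fun e he z hz => ⟨e, he, hz⟩
  have kS : W₁ ∩ W₂ ⊆ ({b, c} : Set V) := by
    rintro z ⟨⟨e, he, hze⟩, hz₂⟩
    rcases Finset.mem_insert.1 he with rfl | he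
    · rcases Sym2.mem_iff.1 hze with rfl | rfl
      · exact Or.inl rfl
      · exact Or.inr rfl
    · have : z = b ∨ z = c := by
        rcases Finset.mem_union.1 he with he | he
        · exact hVR z (Or.inl ⟨e, he, hze⟩) hz₂
        · exact hVR z (Or.inr ⟨e, he, hze⟩) hz₂
      rcases this with rfl | rfl
      · exact Or.inl rfl
      · exact Or.inr rfl
  have kSE : ({s(a, b), s(b, c), s(c, d)} : Finset (Sym2 V)) ⊆ E₁ := by
    intro e he
    simp only [Finset.mem_insert, Finset.mem_singleton] at he
    rcases he with rfl | rfl | rfl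
    · exact Finset.mem_insert_of_mem (Finset.mem_union_left _ (Finset.mem_insert_self _ _))
    · exact Finset.mem_insert_self _ _
    · exact Finset.mem_insert_of_mem (Finset.mem_union_right _ (Finset.mem_insert_self _ _))
  have kM : N₁ ∪ N₂ ⊆ E₁ := fun e he => by
    rcases Finset.mem_union.1 he with h | h
    · exact Finset.mem_insert_of_mem (Finset.mem_union_left _ (Finset.mem_insert_of_mem h))
    · exact Finset.mem_insert_of_mem (Finset.mem_union_right _ (Finset.mem_insert_of_mem h))
  -- input (i): the AND-drift of `S` on `M = N₁ ⊔_m N₂` (file 27)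
  have hY₁ : ∀ h' : Finset (Sym2 V) → ℝ, (∀ ⦃A B : Finset (Sym2 V)⦄, A ⊆ B → B ⊆ N₁ → h' A ≤ h' B) →
      ∑ γ₁ ∈ N₁.powerset, (q ^ (clusterCount (↑(insert s(b, m) (insert s(a, b) γ₁)) : BondConfig V) ∅ +
          clusterCount (↑(N₁ \ γ₁) : BondConfig V) ∅) -
        q ^ (clusterCount (↑(insert s(b, m) (insert s(a, b) (N₁ \ γ₁))) : BondConfig V) ∅ +
          clusterCount (↑γ₁ : BondConfig V) ∅)) * h' γ₁ ≤ 0 := by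
    intro h' hm
    have key := and2_side_nonpos hq0 hq1 hA₁ hbm (Finset.mem_insert_self _ _) (h := h')
      (by rw [Finset.erase_insert habN]; exact hm)
    rwa [Finset.erase_insert habN] at key
  have hU₁ : ∀ h' : Finset (Sym2 V) → ℝ, (∀ ⦃A B : Finset (Sym2 V)⦄, A ⊆ B → B ⊆ N₁ → h' A ≤ h' B) →
      ∑ γ₁ ∈ N₁.powerset, (q ^ (clusterCount (↑(insert s(a, b) γ₁) : BondConfig V) ∅ +
          clusterCount (↑(N₁ \ γ₁) : BondConfig V) ∅) -
        q ^ (clusterCount (↑(insert s(a, b) (N₁ \ γ₁)) : BondConfig V) ∅ + clusterCount (↑γ₁ : BondConfig V) ∅)) * h' γ₁ ≤ 0 := by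
    intro h' hm
    have key := and1_side_nonpos hq0 hq1 hA₁ hbm (Finset.mem_insert_self _ _) (h := h')
      (by rw [Finset.erase_insert habN]; exact hm)
    rwa [Finset.erase_insert habN] at key
  have hY₂ : ∀ h' : Finset (Sym2 V) → ℝ, (∀ ⦃A B : Finset (Sym2 V)⦄, A ⊆ B → B ⊆ N₂ → h' A ≤ h' B) →
      ∑ γ₂ ∈ N₂.powerset, (q ^ (clusterCount (↑(insert s(m, c) (insert s(c, d) γ₂)) : BondConfig V) ∅ +
          clusterCount (↑(N₂ \ γ₂) : BondConfig V) ∅) -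
        q ^ (clusterCount (↑(insert s(m, c) (insert s(c, d) (N₂ \ γ₂))) : BondConfig V) ∅ +
          clusterCount (↑γ₂ : BondConfig V) ∅)) * h' γ₂ ≤ 0 := by
    intro h' hm
    have key := and2_side_nonpos hq0 hq1 hA₂ hmc (Finset.mem_insert_self _ _) (h := h')
      (by rw [Finset.erase_insert hcdN]; exact hm)
    rwa [Finset.erase_insert hcdN] at key
  have hU₂ : ∀ h' : Finset (Sym2 V) → ℝ, (∀ ⦃A B : Finset (Sym2 V)⦄, A ⊆ B → B ⊆ N₂ → h' A ≤ h' B) →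
      ∑ γ₂ ∈ N₂.powerset, (q ^ (clusterCount (↑(insert s(c, d) γ₂) : BondConfig V) ∅ +
          clusterCount (↑(N₂ \ γ₂) : BondConfig V) ∅) -
        q ^ (clusterCount (↑(insert s(c, d) (N₂ \ γ₂)) : BondConfig V) ∅ + clusterCount (↑γ₂ : BondConfig V) ∅)) * h' γ₂ ≤ 0 := by
    intro h' hm
    have key := and1_side_nonpos hq0 hq1 hA₂ hmc (Finset.mem_insert_self _ _) (h := h')
      (by rw [Finset.erase_insert hcdN]; exact hm)
    rwa [Finset.erase_insert hcdN] at key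
  have hA : ∀ h' : Finset (Sym2 V) → ℝ, (∀ ⦃A B : Finset (Sym2 V)⦄, A ⊆ B → B ⊆ N₁ ∪ N₂ → h' A ≤ h' B) →
      ∑ γ ∈ (N₁ ∪ N₂).powerset,
        (q ^ (clusterCount (↑(γ ∪ {s(a, b), s(b, c), s(c, d)}) : BondConfig V) ∅ + clusterCount (↑((N₁ ∪ N₂) \ γ) : BondConfig V) ∅) -
            q ^ (clusterCount (↑((N₁ ∪ N₂) \ γ ∪ {s(a, b), s(b, c), s(c, d)}) : BondConfig V) ∅ + clusterCount (↑γ : BondConfig V) ∅)) *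
          h' γ ≤ 0 :=
    fun h' hm => and4_series_nonpos hq0 h₁ h₂ hS hbV₂ hcV₁ hbm' hcm' hbc (Finset.mem_insert_self _ _) (Finset.mem_insert_self _ _)
      hdN (Finset.subset_insert _ _) (Finset.subset_insert _ _) hY₁ hU₁ hY₂ hU₂ hm
  -- input (ii): the contracted AND-drift of `S` on `M`; `A′ · A″` is TTSP between `b, c`
  have hK : IsTTSP (insert s(a, b) (insert s(c, d) (N₁ ∪ N₂))) b c := by
    have key := IsTTSP.series hA₁ hA₂ hd hV hbA₂ hcA₁
    rwa [insert_union_insert_eq] at key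
  have habM : s(a, b) ∉ N₁ ∪ N₂ := fun hh => by
    rcases Finset.mem_union.1 hh with h' | h'
    · exact habN h'
    · exact hbA₂ _ (Finset.mem_insert_of_mem h') (Sym2.mem_mk_right a b)
  have hcdM : s(c, d) ∉ N₁ ∪ N₂ := fun hh => by
    rcases Finset.mem_union.1 hh with h' | h'
    · exact hcA₁ _ (Finset.mem_insert_of_mem h') (Sym2.mem_mk_left c d)
    · exact hcdN h'
  have habcd : s(a, b) ≠ s(c, d) := fun hh =>
    Finset.disjoint_left.1 hd (Finset.mem_insert_self _ _) (hh ▸ Finset.mem_insert_self _ _)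
  have hbcK : s(b, c) ∉ insert s(a, b) (insert s(c, d) (N₁ ∪ N₂)) := by
    rw [← insert_union_insert_eq]
    intro hh
    rcases Finset.mem_union.1 hh with h' | h'
    · exact hcA₁ _ h' (Sym2.mem_mk_right b c)
    · exact hbA₂ _ h' (Sym2.mem_mk_left b c)
  -- input (ii): the contracted AND-drift of `S` on `M`
  have hAc : ∀ h' : Finset (Sym2 V) → ℝ, (∀ ⦃A B : Finset (Sym2 V)⦄, A ⊆ B → B ⊆ N₁ ∪ N₂ → h' A ≤ h' B) →
      ∑ γ ∈ (N₁ ∪ N₂).powerset,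
        (q ^ (clusterCount (↑(γ ∪ {s(a, b), s(b, c), s(c, d)}) : BondConfig V) ∅ +
              clusterCount (↑((N₁ ∪ N₂) \ γ ∪ {s(b, c)}) : BondConfig V) ∅) -
          q ^ (clusterCount (↑((N₁ ∪ N₂) \ γ ∪ {s(a, b), s(b, c), s(c, d)}) : BondConfig V) ∅ +
              clusterCount (↑(γ ∪ {s(b, c)}) : BondConfig V) ∅)) * h' γ ≤ 0 :=
    fun h' hm => andc_side_nonpos hq0 hq1 hK habM hcdM habcd hbcK hm
  -- input (iii): Theorem U on `R`
  have hU : ∀ h' : Finset (Sym2 V) → ℝ, (∀ ⦃A B : Finset (Sym2 V)⦄, A ⊆ B → B ⊆ R → h' A ≤ h' B) → 0 ≤ apUpc q R b c h' :=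
    fun h' hm => apUpc_nonneg_of_isTTSP hq0 hR R le_rfl h' hm
  have main := and4_theta_nonpos hq0 hq1 k₁ k₂ kS hbc kSE hdNR kM le_rfl hA hAc hU hmono
  linarith

end Main

end FK

end Summit.CriticalPhenomena.PercolationContinuityZ3.Theorems

end
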